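import Summits.AtomisticToContinuum.Crystallization.Theorems.ChargedEnergyGapKissing
import HarnessLib

/-!
# Charged energy gap — lens-3 g63, part P-Z₅a″: the SECOND CENSUS — 109 sites of a Barlow stacking within `3` of every site, window-uniformly

Cell `decomp-a2c`, seat lens-3, generation 63, part P-Z₅a″ (after P-Z₅a `ChargedEnergyGapKissing`).  ELEMENTARY·PROVED (Barlow side).
The count that decides the purely geometric attribution scheme «6 × 109» of the bulk far residue (seat HANDOFF §J (J7)/(J8)): every site
`(k, i, j)` of a Barlow stacking on the coherence window (`9/10 ≤ a ≤ 11/10`, `27/50·a² ≤ h² ≤ 121/150·a²`, any Hägg sequence `s`) has at least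
`109 = 31 + 2·27 + 2·12` sites within distance `3`: the `31` in-layer offsets with `i² + ij + j² ≤ 7` (`shellTab0`), `27` offsets in each
adjacent layer (`shellTab1`, carried by the label step `±s`), and `12` in each second layer — `shellTab2S` when the two label steps agree
(net lateral offset `±2w`), `shellTab2` when they cancel (no offset).  Each squared distance is `a²·q + Δk²·h²` (`dist_sq_sameLayer`,
`dist_sq_succLayer`, `dist_sq_succ2Layer`, …), LINEAR in `(a², h²)`, so the bound `≤ 9` is checked at the window's corner.  The index map
`shellIdx : Fin 31 ⊕ Fin 27 ⊕ Fin 27 ⊕ Fin 12 ⊕ Fin 12 → ℤ³` is injective (tables injective by `decide`, layers by their index), whence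
★★ `exists_finset_card_109`: a finset of `109` sites of the stacking within `3` of `barlowPos a h s k i j`.  (The minimum over the window
is exactly `109`, attained at `a = 11/10`, `h² = 121/150·a²`, stacking `…ABCBABCBA…`: seat census num/barlow_census.py.)  The transport to
labelled references (109 distinct sites within `4` of every site, within `619/100` of every point) is the sequel P-Z₅a‴.
-/

noncomputable section

open scoped Classical

open Literature.MathematicalPhysics.StatisticalMechanics Literature.Geometry.DiscreteGeometry
open Summit.AtomisticToContinuum.Crystallization.Theses.PricedLinkCensus
open Summit.AtomisticToContinuum.Crystallization.Theorems.ChargedEnergyGapNegative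

namespace Summit.AtomisticToContinuum.Crystallization.Theorems.ChargedEnergyGapChartDial

/-! ## §1 The offset tables -/

/-- The `31` in-layer offsets `(Δi, Δj)` with `Δi² + Δi Δj + Δj² ≤ 7`. [formal bookkeeping] -/
def shellTab0 : Fin 31 → ℤ × ℤ :=
  ![(0, 0), (1, 0), (-1, 0), (0, 1), (0, -1), (1, -1), (-1, 1), (1, 1), (-1, -1), (2, -1), (-2, 1), (1, -2), (-1, 2), (2, 0), (-2, 0), (0, 2),
    (0, -2), (2, -2), (-2, 2), (2, 1), (1, 2), (-2, -1), (-1, -2), (3, -1), (-3, 1), (3, -2), (-3, 2), (1, -3), (-1, 3), (2, -3), (-2, 3)]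

/-- The `27` adjacent-layer offsets `(Δi, Δj)` (in units of the label step) with `Δi² + Δi Δj + Δj² + Δi + Δj ≤ 6`. [formal bookkeeping] -/
def shellTab1 : Fin 27 → ℤ × ℤ :=
  ![(0, 0), (-1, 0), (0, -1), (1, -1), (-1, 1), (-1, -1), (1, 0), (0, 1), (-2, 0), (0, -2), (-2, 1), (1, -2), (-2, -1), (-1, -2), (2, -1),
    (-1, 2), (2, -2), (-2, 2), (1, 1), (-3, 1), (1, -3), (2, 0), (0, 2), (-3, 0), (0, -3), (-3, 2), (2, -3)]

/-- The `12` second-layer offsets when the two label steps cancel (no lateral offset): `Δi² + Δi Δj + Δj² ≤ 3`. [formal bookkeeping] -/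
def shellTab2 : Fin 12 → ℤ × ℤ :=
  ![(0, 0), (1, 0), (-1, 0), (0, 1), (0, -1), (1, -1), (-1, 1), (1, 1), (-1, -1), (2, -1), (-2, 1), (1, -2)]

/-- The `12` second-layer offsets when the two label steps agree (lateral offset `2w`, in units of the step): `Δi² + Δi Δj + Δj² + 2(Δi + Δj) ≤ 1`.
[formal bookkeeping] -/
def shellTab2S : Fin 12 → ℤ × ℤ :=
  ![(-1, 0), (0, -1), (-1, -1), (0, 0), (-2, 0), (0, -2), (-1, 1), (1, -1), (-2, -1), (-1, -2), (-2, 1), (1, -2)]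

/-- `shellTab0_injective` (docstring added by the landing lane; see the module docstring). [formal bookkeeping] -/
theorem shellTab0_injective : Function.Injective shellTab0 := by decide
/-- `shellTab1_injective` (docstring added by the landing lane; see the module docstring). [formal bookkeeping] -/
theorem shellTab1_injective : Function.Injective shellTab1 := by decide
/-- `shellTab2_injective` (docstring added by the landing lane; see the module docstring). [formal bookkeeping] -/
theorem shellTab2_injective : Function.Injective shellTab2 := by decide
/-- `shellTab2S_injective` (docstring added by the landing lane; see the module docstring). [formal bookkeeping] -/
theorem shellTab2S_injective : Function.Injective shellTab2S := by decide

/-- `shellTab0_norm_le` (docstring added by the landing lane; see the module docstring). [formal bookkeeping] -/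
theorem shellTab0_norm_le (m : Fin 31) :
    (shellTab0 m).1 * (shellTab0 m).1 + (shellTab0 m).1 * (shellTab0 m).2 + (shellTab0 m).2 * (shellTab0 m).2 ≤ 7 := by
  revert m; decide
/-- `shellTab1_norm_le` (docstring added by the landing lane; see the module docstring). [formal bookkeeping] -/
theorem shellTab1_norm_le (m : Fin 27) : (shellTab1 m).1 * (shellTab1 m).1 + (shellTab1 m).1 * (shellTab1 m).2 +
    (shellTab1 m).2 * (shellTab1 m).2 + (shellTab1 m).1 + (shellTab1 m).2 ≤ 6 := by
  revert m; decide
/-- `shellTab2_norm_le` (docstring added by the landing lane; see the module docstring). [formal bookkeeping] -/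
theorem shellTab2_norm_le (m : Fin 12) :
    (shellTab2 m).1 * (shellTab2 m).1 + (shellTab2 m).1 * (shellTab2 m).2 + (shellTab2 m).2 * (shellTab2 m).2 ≤ 3 := by
  revert m; decide
/-- `shellTab2S_norm_le` (docstring added by the landing lane; see the module docstring). [formal bookkeeping] -/
theorem shellTab2S_norm_le (m : Fin 12) : (shellTab2S m).1 * (shellTab2S m).1 + (shellTab2S m).1 * (shellTab2S m).2 +
    (shellTab2S m).2 * (shellTab2S m).2 + 2 * ((shellTab2S m).1 + (shellTab2S m).2) ≤ 1 := by
  revert m; decide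

/-! ## §2 Squared distances to the second layers -/

section Barlow

variable {a h : ℝ} {s : ℤ → ℤ}

/-- Squared distances to the second layer above (net label offset `L = s k + s (k+1) ∈ {0, ±2}`). [formal bookkeeping] -/
theorem dist_sq_succ2Layer (k i j i' j' : ℤ) : dist (barlowPos a h s (k + 2) i' j') (barlowPos a h s k i j) ^ 2 =
    a ^ 2 * (((i' : ℝ) - i) ^ 2 + ((i' : ℝ) - i) * ((j' : ℝ) - j) + ((j' : ℝ) - j) ^ 2 +
      (((i' : ℝ) - i) + ((j' : ℝ) - j)) * ((s k : ℝ) + s (k + 1)) + ((s k : ℝ) + s (k + 1)) ^ 2 / 3) + 4 * h ^ 2 := by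
  have h3 : (√3 : ℝ) ^ 2 = 3 := Real.sq_sqrt (by norm_num)
  have hl : haggLabel s (k + 2) = haggLabel s k + s k + s (k + 1) := by
    rw [show k + 2 = k + 1 + 1 by ring, haggLabel_succ, haggLabel_succ]
  rw [dist_barlowPos_sq, hl]
  push_cast
  linear_combination (a ^ 2 * (((j' : ℝ) - j) + ((s k : ℝ) + s (k + 1)) / 3) ^ 2 / 4) * h3

/-- Squared distances to the second layer below (net label offset `−(s (k−2) + s (k−1))`). [formal bookkeeping] -/
theorem dist_sq_pred2Layer (k i j i' j' : ℤ) : dist (barlowPos a h s (k - 2) i' j') (barlowPos a h s k i j) ^ 2 =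
    a ^ 2 * (((i' : ℝ) - i) ^ 2 + ((i' : ℝ) - i) * ((j' : ℝ) - j) + ((j' : ℝ) - j) ^ 2 -
      (((i' : ℝ) - i) + ((j' : ℝ) - j)) * ((s (k - 2) : ℝ) + s (k - 1)) + ((s (k - 2) : ℝ) + s (k - 1)) ^ 2 / 3) + 4 * h ^ 2 := by
  have h3 : (√3 : ℝ) ^ 2 = 3 := Real.sq_sqrt (by norm_num)
  have hl : haggLabel s (k - 2) = haggLabel s k - s (k - 2) - s (k - 1) := by
    have h1 := haggLabel_succ s (k - 2)
    have h2 := haggLabel_succ s (k - 1)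
    rw [show k - 2 + 1 = k - 1 by ring] at h1
    rw [sub_add_cancel] at h2
    linarith
  rw [dist_barlowPos_sq, hl]
  push_cast
  linear_combination (a ^ 2 * (((j' : ℝ) - j) - ((s (k - 2) : ℝ) + s (k - 1)) / 3) ^ 2 / 4) * h3

/-! ## §3 The five families are within `3` on the window (squared distances are linear in `(a², h²)`: check the corner) -/

variable (ha : 9 / 10 ≤ a ∧ a ≤ 11 / 10) (hh : 0 < h ∧ 27 / 50 * a ^ 2 ≤ h ^ 2 ∧ h ^ 2 ≤ 121 / 150 * a ^ 2) (hs : IsHaggSeq s)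
include ha

/-- Layer `k`: an offset `(i₀, j₀)` with `i₀² + i₀ j₀ + j₀² ≤ 7` is within `3` (`7a² ≤ 8.47`). -/
theorem dist_sameLayer_offset_le (k i j i₀ j₀ : ℤ) (hq : i₀ * i₀ + i₀ * j₀ + j₀ * j₀ ≤ 7) :
    dist (barlowPos a h s k (i + i₀) (j + j₀)) (barlowPos a h s k i j) ≤ 3 := by
  have hA : a ^ 2 ≤ 121 / 100 := by nlinarith [ha.1, ha.2]
  have hq' : (i₀ : ℝ) * i₀ + i₀ * j₀ + j₀ * j₀ ≤ 7 := by exact_mod_cast hq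
  refine (pow_le_pow_iff_left₀ dist_nonneg (by norm_num) two_ne_zero).1 ?_
  calc dist (barlowPos a h s k (i + i₀) (j + j₀)) (barlowPos a h s k i j) ^ 2 = a ^ 2 * ((i₀ : ℝ) * i₀ + i₀ * j₀ + j₀ * j₀) := by
        rw [dist_sq_sameLayer]; push_cast; ring
    _ ≤ 3 ^ 2 := by nlinarith [mul_le_mul_of_nonneg_left hq' (sq_nonneg a)]

include hh hs

/-- Layer `k + 1`: an offset `s k • (i₀, j₀)` with `i₀² + i₀ j₀ + j₀² + i₀ + j₀ ≤ 6` is within `3` (`19/3·a² + h² ≤ 8.64`). -/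
theorem dist_succLayer_offset_le (k i j i₀ j₀ : ℤ) (hq : i₀ * i₀ + i₀ * j₀ + j₀ * j₀ + i₀ + j₀ ≤ 6) :
    dist (barlowPos a h s (k + 1) (i + s k * i₀) (j + s k * j₀)) (barlowPos a h s k i j) ≤ 3 := by
  have hA : a ^ 2 ≤ 121 / 100 := by nlinarith [ha.1, ha.2]
  have hB := hh.2.2
  have hsq : ((s k : ℤ) : ℝ) ^ 2 = 1 := by rcases hs k with h0 | h0 <;> rw [h0] <;> norm_num
  have hq' : (i₀ : ℝ) * i₀ + i₀ * j₀ + j₀ * j₀ + i₀ + j₀ ≤ 6 := by exact_mod_cast hq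
  refine (pow_le_pow_iff_left₀ dist_nonneg (by norm_num) two_ne_zero).1 ?_
  calc dist (barlowPos a h s (k + 1) (i + s k * i₀) (j + s k * j₀)) (barlowPos a h s k i j) ^ 2
        = a ^ 2 * (((i₀ : ℝ) * i₀ + i₀ * j₀ + j₀ * j₀ + i₀ + j₀) + 1 / 3) + h ^ 2 := by
        rw [dist_sq_succLayer hs]; push_cast
        linear_combination (a ^ 2 * ((i₀ : ℝ) * i₀ + i₀ * j₀ + j₀ * j₀ + i₀ + j₀)) * hsq
    _ ≤ 3 ^ 2 := by nlinarith [mul_le_mul_of_nonneg_left hq' (sq_nonneg a)]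

/-- Layer `k − 1`: an offset `−s (k−1) • (i₀, j₀)` with `i₀² + i₀ j₀ + j₀² + i₀ + j₀ ≤ 6` is within `3`. -/
theorem dist_predLayer_offset_le (k i j i₀ j₀ : ℤ) (hq : i₀ * i₀ + i₀ * j₀ + j₀ * j₀ + i₀ + j₀ ≤ 6) :
    dist (barlowPos a h s (k - 1) (i - s (k - 1) * i₀) (j - s (k - 1) * j₀)) (barlowPos a h s k i j) ≤ 3 := by
  have hA : a ^ 2 ≤ 121 / 100 := by nlinarith [ha.1, ha.2]
  have hB := hh.2.2
  have hsq : ((s (k - 1) : ℤ) : ℝ) ^ 2 = 1 := by rcases hs (k - 1) with h0 | h0 <;> rw [h0] <;> norm_num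
  have hq' : (i₀ : ℝ) * i₀ + i₀ * j₀ + j₀ * j₀ + i₀ + j₀ ≤ 6 := by exact_mod_cast hq
  refine (pow_le_pow_iff_left₀ dist_nonneg (by norm_num) two_ne_zero).1 ?_
  calc dist (barlowPos a h s (k - 1) (i - s (k - 1) * i₀) (j - s (k - 1) * j₀)) (barlowPos a h s k i j) ^ 2
        = a ^ 2 * (((i₀ : ℝ) * i₀ + i₀ * j₀ + j₀ * j₀ + i₀ + j₀) + 1 / 3) + h ^ 2 := by
        rw [dist_sq_predLayer hs]; push_cast
        linear_combination (a ^ 2 * ((i₀ : ℝ) * i₀ + i₀ * j₀ + j₀ * j₀ + i₀ + j₀)) * hsq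
    _ ≤ 3 ^ 2 := by nlinarith [mul_le_mul_of_nonneg_left hq' (sq_nonneg a)]

/-- Layer `k + 2`, agreeing steps (`s (k+1) = s k`, net lateral offset `2 s k • w`): an offset `s k • (i₀, j₀)` with
`i₀² + i₀ j₀ + j₀² + 2(i₀ + j₀) ≤ 1` is within `3` (`7/3·a² + 4h² ≤ 6.73`). -/
theorem dist_succ2Layer_offsetS_le (k i j i₀ j₀ : ℤ) (he : s (k + 1) = s k) (hq : i₀ * i₀ + i₀ * j₀ + j₀ * j₀ + 2 * (i₀ + j₀) ≤ 1) :
    dist (barlowPos a h s (k + 2) (i + s k * i₀) (j + s k * j₀)) (barlowPos a h s k i j) ≤ 3 := by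
  have hA : a ^ 2 ≤ 121 / 100 := by nlinarith [ha.1, ha.2]
  have hB := hh.2.2
  have hsq : ((s k : ℤ) : ℝ) ^ 2 = 1 := by rcases hs k with h0 | h0 <;> rw [h0] <;> norm_num
  have hq' : (i₀ : ℝ) * i₀ + i₀ * j₀ + j₀ * j₀ + 2 * (i₀ + j₀) ≤ 1 := by exact_mod_cast hq
  refine (pow_le_pow_iff_left₀ dist_nonneg (by norm_num) two_ne_zero).1 ?_
  calc dist (barlowPos a h s (k + 2) (i + s k * i₀) (j + s k * j₀)) (barlowPos a h s k i j) ^ 2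
        = a ^ 2 * (((i₀ : ℝ) * i₀ + i₀ * j₀ + j₀ * j₀ + 2 * (i₀ + j₀)) + 4 / 3) + 4 * h ^ 2 := by
        rw [dist_sq_succ2Layer, he]; push_cast
        linear_combination (a ^ 2 * ((i₀ : ℝ) * i₀ + i₀ * j₀ + j₀ * j₀ + 2 * (i₀ + j₀) + 4 / 3)) * hsq
    _ ≤ 3 ^ 2 := by nlinarith [mul_le_mul_of_nonneg_left hq' (sq_nonneg a)]

/-- Layer `k + 2`, cancelling steps (`s (k+1) ≠ s k`, no net lateral offset): an offset `(i₀, j₀)` with `i₀² + i₀ j₀ + j₀² ≤ 3` is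
within `3` (`3a² + 4h² ≤ 7.54`). -/
theorem dist_succ2Layer_offset_le (k i j i₀ j₀ : ℤ) (he : s (k + 1) ≠ s k) (hq : i₀ * i₀ + i₀ * j₀ + j₀ * j₀ ≤ 3) :
    dist (barlowPos a h s (k + 2) (i + i₀) (j + j₀)) (barlowPos a h s k i j) ≤ 3 := by
  have hA : a ^ 2 ≤ 121 / 100 := by nlinarith [ha.1, ha.2]
  have hB := hh.2.2
  have hL : (s k : ℝ) + s (k + 1) = 0 := by
    rcases hs k with hk | hk <;> rcases hs (k + 1) with hk' | hk' <;> simp_all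
  have hq' : (i₀ : ℝ) * i₀ + i₀ * j₀ + j₀ * j₀ ≤ 3 := by exact_mod_cast hq
  refine (pow_le_pow_iff_left₀ dist_nonneg (by norm_num) two_ne_zero).1 ?_
  calc dist (barlowPos a h s (k + 2) (i + i₀) (j + j₀)) (barlowPos a h s k i j) ^ 2
        = a ^ 2 * ((i₀ : ℝ) * i₀ + i₀ * j₀ + j₀ * j₀) + 4 * h ^ 2 := by
        rw [dist_sq_succ2Layer]; push_cast
        linear_combination (a ^ 2 * ((i₀ : ℝ) + j₀ + ((s k : ℝ) + s (k + 1)) / 3)) * hL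
    _ ≤ 3 ^ 2 := by nlinarith [mul_le_mul_of_nonneg_left hq' (sq_nonneg a)]

/-- Layer `k − 2`, agreeing steps (`s (k−2) = s (k−1)`): an offset `−s (k−1) • (i₀, j₀)` with `i₀² + i₀ j₀ + j₀² + 2(i₀ + j₀) ≤ 1` is
within `3`. -/
theorem dist_pred2Layer_offsetS_le (k i j i₀ j₀ : ℤ) (he : s (k - 2) = s (k - 1))
    (hq : i₀ * i₀ + i₀ * j₀ + j₀ * j₀ + 2 * (i₀ + j₀) ≤ 1) :
    dist (barlowPos a h s (k - 2) (i - s (k - 1) * i₀) (j - s (k - 1) * j₀)) (barlowPos a h s k i j) ≤ 3 := by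
  have hA : a ^ 2 ≤ 121 / 100 := by nlinarith [ha.1, ha.2]
  have hB := hh.2.2
  have hsq : ((s (k - 1) : ℤ) : ℝ) ^ 2 = 1 := by rcases hs (k - 1) with h0 | h0 <;> rw [h0] <;> norm_num
  have hq' : (i₀ : ℝ) * i₀ + i₀ * j₀ + j₀ * j₀ + 2 * (i₀ + j₀) ≤ 1 := by exact_mod_cast hq
  refine (pow_le_pow_iff_left₀ dist_nonneg (by norm_num) two_ne_zero).1 ?_
  calc dist (barlowPos a h s (k - 2) (i - s (k - 1) * i₀) (j - s (k - 1) * j₀)) (barlowPos a h s k i j) ^ 2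
        = a ^ 2 * (((i₀ : ℝ) * i₀ + i₀ * j₀ + j₀ * j₀ + 2 * (i₀ + j₀)) + 4 / 3) + 4 * h ^ 2 := by
        rw [dist_sq_pred2Layer, he]; push_cast
        linear_combination (a ^ 2 * ((i₀ : ℝ) * i₀ + i₀ * j₀ + j₀ * j₀ + 2 * (i₀ + j₀) + 4 / 3)) * hsq
    _ ≤ 3 ^ 2 := by nlinarith [mul_le_mul_of_nonneg_left hq' (sq_nonneg a)]

/-- Layer `k − 2`, cancelling steps (`s (k−2) ≠ s (k−1)`): an offset `(i₀, j₀)` with `i₀² + i₀ j₀ + j₀² ≤ 3` is within `3`. -/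
theorem dist_pred2Layer_offset_le (k i j i₀ j₀ : ℤ) (he : s (k - 2) ≠ s (k - 1)) (hq : i₀ * i₀ + i₀ * j₀ + j₀ * j₀ ≤ 3) :
    dist (barlowPos a h s (k - 2) (i + i₀) (j + j₀)) (barlowPos a h s k i j) ≤ 3 := by
  have hA : a ^ 2 ≤ 121 / 100 := by nlinarith [ha.1, ha.2]
  have hB := hh.2.2
  have hL : (s (k - 2) : ℝ) + s (k - 1) = 0 := by
    rcases hs (k - 2) with hk | hk <;> rcases hs (k - 1) with hk' | hk' <;> simp_all
  have hq' : (i₀ : ℝ) * i₀ + i₀ * j₀ + j₀ * j₀ ≤ 3 := by exact_mod_cast hq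
  refine (pow_le_pow_iff_left₀ dist_nonneg (by norm_num) two_ne_zero).1 ?_
  calc dist (barlowPos a h s (k - 2) (i + i₀) (j + j₀)) (barlowPos a h s k i j) ^ 2
        = a ^ 2 * ((i₀ : ℝ) * i₀ + i₀ * j₀ + j₀ * j₀) + 4 * h ^ 2 := by
        rw [dist_sq_pred2Layer]; push_cast
        linear_combination (a ^ 2 * (-((i₀ : ℝ) + j₀) + ((s (k - 2) : ℝ) + s (k - 1)) / 3)) * hL
    _ ≤ 3 ^ 2 := by nlinarith [mul_le_mul_of_nonneg_left hq' (sq_nonneg a)]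

end Barlow

/-! ## §4 The index map on `Fin 31 ⊕ Fin 27 ⊕ Fin 27 ⊕ Fin 12 ⊕ Fin 12` and its injectivity -/

/-- The `109` index triples `(layer, i, j)` around the site `(k, i, j)`; the second-layer families branch on whether the two label steps agree.
[formal bookkeeping] -/
def shellIdx (s : ℤ → ℤ) (k i j : ℤ) : Fin 31 ⊕ Fin 27 ⊕ Fin 27 ⊕ Fin 12 ⊕ Fin 12 → ℤ × ℤ × ℤ :=
  Sum.elim (fun m => (k, i + (shellTab0 m).1, j + (shellTab0 m).2))
    (Sum.elim (fun m => (k + 1, i + s k * (shellTab1 m).1, j + s k * (shellTab1 m).2))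
      (Sum.elim (fun m => (k - 1, i - s (k - 1) * (shellTab1 m).1, j - s (k - 1) * (shellTab1 m).2))
        (Sum.elim
          (fun m => if s (k + 1) = s k then (k + 2, i + s k * (shellTab2S m).1, j + s k * (shellTab2S m).2)
            else (k + 2, i + (shellTab2 m).1, j + (shellTab2 m).2))
          (fun m => if s (k - 2) = s (k - 1) then (k - 2, i - s (k - 1) * (shellTab2S m).1, j - s (k - 1) * (shellTab2S m).2)
            else (k - 2, i + (shellTab2 m).1, j + (shellTab2 m).2)))))

/-- The layer coordinate of each family. [formal bookkeeping] -/
theorem shellIdx_fst (s : ℤ → ℤ) (k i j : ℤ) :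
    (∀ m, (shellIdx s k i j (Sum.inl m)).1 = k) ∧ (∀ m, (shellIdx s k i j (Sum.inr (Sum.inl m))).1 = k + 1) ∧
      (∀ m, (shellIdx s k i j (Sum.inr (Sum.inr (Sum.inl m)))).1 = k - 1) ∧
        (∀ m, (shellIdx s k i j (Sum.inr (Sum.inr (Sum.inr (Sum.inl m))))).1 = k + 2) ∧
          ∀ m, (shellIdx s k i j (Sum.inr (Sum.inr (Sum.inr (Sum.inr m))))).1 = k - 2 := by
  refine ⟨fun m => rfl, fun m => rfl, fun m => rfl, fun m => ?_, fun m => ?_⟩ <;> simp only [shellIdx, Sum.elim_inr, Sum.elim_inl] <;>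
    split_ifs <;> rfl

/-- ★ The `109` index triples are pairwise distinct (a Hägg sequence takes the values `±1`). -/
theorem shellIdx_injective {s : ℤ → ℤ} (hs : IsHaggSeq s) (k i j : ℤ) : Function.Injective (shellIdx s k i j) := by
  have hk0 : s k ≠ 0 := by rcases hs k with h0 | h0 <;> rw [h0] <;> norm_num
  have hk1 : s (k - 1) ≠ 0 := by rcases hs (k - 1) with h0 | h0 <;> rw [h0] <;> norm_num
  obtain ⟨e0, e1, e1', e2, e2'⟩ := shellIdx_fst s k i j
  -- injectivity of each family
  have i0 : Function.Injective fun m : Fin 31 => shellIdx s k i j (Sum.inl m) := fun m m' hmm => by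
    refine shellTab0_injective (Prod.ext ?_ ?_) <;> simp only [shellIdx, Sum.elim_inl, Prod.mk.injEq] at hmm <;> omega
  have i1 : Function.Injective fun m : Fin 27 => shellIdx s k i j (Sum.inr (Sum.inl m)) := fun m m' hmm => by
    simp only [shellIdx, Sum.elim_inr, Sum.elim_inl, Prod.mk.injEq] at hmm
    exact shellTab1_injective (Prod.ext (mul_left_cancel₀ hk0 (by omega)) (mul_left_cancel₀ hk0 (by omega)))
  have i1' : Function.Injective fun m : Fin 27 => shellIdx s k i j (Sum.inr (Sum.inr (Sum.inl m))) := fun m m' hmm => by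
    simp only [shellIdx, Sum.elim_inr, Sum.elim_inl, Prod.mk.injEq] at hmm
    exact shellTab1_injective (Prod.ext (mul_left_cancel₀ hk1 (by omega)) (mul_left_cancel₀ hk1 (by omega)))
  have i2 : Function.Injective fun m : Fin 12 => shellIdx s k i j (Sum.inr (Sum.inr (Sum.inr (Sum.inl m)))) := fun m m' hmm => by
    simp only [shellIdx, Sum.elim_inr, Sum.elim_inl] at hmm
    split_ifs at hmm with hc
    · simp only [Prod.mk.injEq] at hmm
      exact shellTab2S_injective (Prod.ext (mul_left_cancel₀ hk0 (by omega)) (mul_left_cancel₀ hk0 (by omega)))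
    · simp only [Prod.mk.injEq] at hmm
      exact shellTab2_injective (Prod.ext (by omega) (by omega))
  have i2' : Function.Injective fun m : Fin 12 => shellIdx s k i j (Sum.inr (Sum.inr (Sum.inr (Sum.inr m)))) := fun m m' hmm => by
    simp only [shellIdx, Sum.elim_inr] at hmm
    split_ifs at hmm with hc
    · simp only [Prod.mk.injEq] at hmm
      exact shellTab2S_injective (Prod.ext (mul_left_cancel₀ hk1 (by omega)) (mul_left_cancel₀ hk1 (by omega)))
    · simp only [Prod.mk.injEq] at hmm
      exact shellTab2_injective (Prod.ext (by omega) (by omega))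
  -- assembling along the layer coordinate
  intro x y hxy
  have h1 := congrArg Prod.fst hxy
  rcases x with m | m | m | m | m <;> rcases y with b | b | b | b | b <;> simp only [e0, e1, e1', e2, e2'] at h1
  any_goals omega
  · rw [i0 hxy]
  · rw [i1 hxy]
  · rw [i1' hxy]
  · rw [i2 hxy]
  · rw [i2' hxy]

/-- The index type has `109` elements. [formal bookkeeping] -/
theorem card_shellIndex : Fintype.card (Fin 31 ⊕ Fin 27 ⊕ Fin 27 ⊕ Fin 12 ⊕ Fin 12) = 109 := by
  simp only [Fintype.card_sum, Fintype.card_fin]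

/-! ## §5 ★★ The second census -/

section Census

variable {a h : ℝ} {s : ℤ → ℤ}

/-- Distinct index triples are distinct points (`a, h > 0`). [formal bookkeeping] -/
theorem barlowPos_triple_injective (ha : 0 < a) (hh : 0 < h) :
    Function.Injective fun t : ℤ × ℤ × ℤ => barlowPos a h s t.1 t.2.1 t.2.2 := by
  intro t t' htt
  by_contra hne
  have hne' : (t.1, t.2.1, t.2.2) ≠ (t'.1, t'.2.1, t'.2.2) := by simpa only [Prod.mk.eta] using hne
  have h1 : min a h ≤ dist (barlowPos a h s t.1 t.2.1 t.2.2) (barlowPos a h s t'.1 t'.2.1 t'.2.2) := le_dist_barlowPos a h s ha.le hh.le hne'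
  have h2 : dist (barlowPos a h s t.1 t.2.1 t.2.2) (barlowPos a h s t'.1 t'.2.1 t'.2.2) = 0 := by rw [dist_eq_zero]; exact htt
  rw [h2] at h1
  exact absurd h1 (not_le.2 (lt_min ha hh))

/-- Every indexed site is within `3` of the centre. -/
theorem dist_shellIdx_le (ha : 9 / 10 ≤ a ∧ a ≤ 11 / 10) (hh : 0 < h ∧ 27 / 50 * a ^ 2 ≤ h ^ 2 ∧ h ^ 2 ≤ 121 / 150 * a ^ 2)
    (hs : IsHaggSeq s) (k i j : ℤ) (ι : Fin 31 ⊕ Fin 27 ⊕ Fin 27 ⊕ Fin 12 ⊕ Fin 12) :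
    dist (barlowPos a h s (shellIdx s k i j ι).1 (shellIdx s k i j ι).2.1 (shellIdx s k i j ι).2.2) (barlowPos a h s k i j) ≤ 3 := by
  rcases ι with m | m | m | m | m
  · exact dist_sameLayer_offset_le ha k i j _ _ (shellTab0_norm_le m)
  · exact dist_succLayer_offset_le ha hh hs k i j _ _ (shellTab1_norm_le m)
  · exact dist_predLayer_offset_le ha hh hs k i j _ _ (shellTab1_norm_le m)
  · simp only [shellIdx, Sum.elim_inr, Sum.elim_inl]
    split_ifs with hc
    · exact dist_succ2Layer_offsetS_le ha hh hs k i j _ _ hc (shellTab2S_norm_le m)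
    · exact dist_succ2Layer_offset_le ha hh hs k i j _ _ hc (shellTab2_norm_le m)
  · simp only [shellIdx, Sum.elim_inr]
    split_ifs with hc
    · exact dist_pred2Layer_offsetS_le ha hh hs k i j _ _ hc (shellTab2S_norm_le m)
    · exact dist_pred2Layer_offset_le ha hh hs k i j _ _ hc (shellTab2_norm_le m)

/-- ★★ **THE SECOND CENSUS**: on the coherence window, every site of a Barlow stacking has a finset of `109` sites of the stacking within
distance `3` of it (itself included). -/
theorem exists_finset_card_109 (ha : 9 / 10 ≤ a ∧ a ≤ 11 / 10) (hh : 0 < h ∧ 27 / 50 * a ^ 2 ≤ h ^ 2 ∧ h ^ 2 ≤ 121 / 150 * a ^ 2)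
    (hs : IsHaggSeq s) (k i j : ℤ) :
    ∃ T : Finset E3, T.card = 109 ∧ ∀ x ∈ T, x ∈ barlowStacking a h s ∧ dist x (barlowPos a h s k i j) ≤ 3 := by
  have ha0 : 0 < a := by linarith [ha.1]
  set F : Fin 31 ⊕ Fin 27 ⊕ Fin 27 ⊕ Fin 12 ⊕ Fin 12 → E3 :=
    fun ι => barlowPos a h s (shellIdx s k i j ι).1 (shellIdx s k i j ι).2.1 (shellIdx s k i j ι).2.2 with hF
  have hFinj : Function.Injective F := (barlowPos_triple_injective ha0 hh.1).comp (shellIdx_injective hs k i j)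
  refine ⟨Finset.univ.image F, ?_, fun x hx => ?_⟩
  · rw [Finset.card_image_of_injective _ hFinj, Finset.card_univ, card_shellIndex]
  · obtain ⟨ι, -, rfl⟩ := Finset.mem_image.1 hx
    exact ⟨barlowPos_mem _ _ _, dist_shellIdx_le ha hh hs k i j ι⟩

/-- ★★ **THE SECOND CENSUS, indexed form**: `109` pairwise distinct sites of the stacking within `3` of `barlowPos a h s k i j`,
indexed by `Fin 109` (the form transported to labelled references in the sequel). -/
theorem exists_fin109_near (ha : 9 / 10 ≤ a ∧ a ≤ 11 / 10) (hh : 0 < h ∧ 27 / 50 * a ^ 2 ≤ h ^ 2 ∧ h ^ 2 ≤ 121 / 150 * a ^ 2)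
    (hs : IsHaggSeq s) (k i j : ℤ) :
    ∃ c : Fin 109 → E3, Function.Injective c ∧ ∀ m, c m ∈ barlowStacking a h s ∧ dist (c m) (barlowPos a h s k i j) ≤ 3 := by
  have ha0 : 0 < a := by linarith [ha.1]
  set F : Fin 31 ⊕ Fin 27 ⊕ Fin 27 ⊕ Fin 12 ⊕ Fin 12 → E3 :=
    fun ι => barlowPos a h s (shellIdx s k i j ι).1 (shellIdx s k i j ι).2.1 (shellIdx s k i j ι).2.2 with hF
  have hFinj : Function.Injective F := (barlowPos_triple_injective ha0 hh.1).comp (shellIdx_injective hs k i j)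
  let e : (Fin 31 ⊕ Fin 27 ⊕ Fin 27 ⊕ Fin 12 ⊕ Fin 12) ≃ Fin 109 := Fintype.equivFinOfCardEq card_shellIndex
  exact ⟨F ∘ e.symm, hFinj.comp e.symm.injective, fun m => ⟨barlowPos_mem _ _ _, dist_shellIdx_le ha hh hs k i j _⟩⟩

/-- Record numerals: the per-layer corner bounds `8.47, 8.64, 6.73, 7.54 ≤ 9` and the count `31 + 27 + 27 + 12 + 12 = 109`. -/
theorem record_secondShell_numerals : (121 : ℝ) / 100 * 7 ≤ 9 ∧ (121 : ℝ) / 100 * (19 / 3 + 121 / 150) ≤ 9 ∧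
    (121 : ℝ) / 100 * (7 / 3 + 4 * (121 / 150)) ≤ 9 ∧ (121 : ℝ) / 100 * (3 + 4 * (121 / 150)) ≤ 9 ∧ 31 + 27 + 27 + 12 + 12 = 109 := by
  refine ⟨by norm_num, by norm_num, by norm_num, by norm_num, by norm_num⟩

end Census

end Summit.AtomisticToContinuum.Crystallization.Theorems.ChargedEnergyGapChartDial

end
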